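import Summits.ResolutionOfSingularities.ResolutionOfSingularities.Theorems.HilbertSamuelEliminationCampaignW42RidgeConeBlowup
import Literature.RingTheory.HilbertSamuel.BennettRegularCentreDim
import HarnessLib

/-!
# [OURS · L1 W4.2] The twist `Λ : X_i ↦ X_i (X_j + 1)`, `X_j ↦ X_j + 1` between a cone and the strict
# transform of the blow-up of its vertex (campaign s42, cell res-hironaka; informal crux `RidgeConfinement`,
# stmt-ResolutionOfSingularities-17845; `--supports`)

HONEST FRAMING. OURS (slot W4.2, prover res-L1-s42-pv-1, gen 2): algebra for the comparison of the local
ring of the blow-up `Bl_0(C)` of the vertex of a cone `C = V(I)` at an ARBITRARY point `ξ` of the exceptional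
divisor `E ∩ U_j = {X_j = 0}` (chart `j`, strict transform ideal `J = ⟨f(X_j := 1)⟩ = I.map (dehomog K j)`,
`…RidgeConeBlowup.lean`) with the local ring of the cone at the point `Λ⁻¹(ξ)` off the hyperplane `X_j = 0`.
`Λ = τ_{e_j} ∘ φ_j` is the tree's blow-up substitution `φ_j : X_i ↦ X_j X_i` followed by the translation
`X_j ↦ X_j + 1`; every `K`-algebra endomorphism `Λ` of `S = K[X]` with
`Λ(X_i) = X_i (X_j + 1)` (`i ≠ j`), `Λ(X_j) = X_j + 1` is meant (hypotheses `hΛj`, `hΛ`).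

* `twist_of_isHomogeneous` — `Λ(f) = (X_j + 1)^d · f(X_j := 1)` for a form `f` of degree `d`; hence
  `twist_mem_map_dehomog`: `Λ(I) ⊆ J`;
* `coordBlowupSubst_univ_injective`, `twist_injective` — `φ_j` (a monomial map with injective exponent
  map) and `Λ` are injective;
* `exists_pow_mul_eq_twist`, `exists_pow_mul_eq_twist_of_mem_map_dehomog` — saturation: for every `g`,
  `(X_j + 1)^N g ∈ Λ(S)` for some `N`, and for `g ∈ J`, `(X_j + 1)^N g ∈ Λ(I)`.

These feed the localization statement `(S/I)_{Λ⁻¹𝔮'} ≅ (S/J)_{𝔮'}` (sequel). Classical (the product structure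
`Bl_0(C) ∩ U_j ≅ (C ∩ {X_j = 1}) × 𝔸¹` of the blow-up of a cone); NOTHING here is a statement of H. Hironaka's
manuscript [Hironaka2017]. AI review is weaker than expert review.
References (orientation only): V. Cossart, U. Jannsen, S. Saito, LNM 2270 (2020), proof of Thm. 3.14;
Y. Hu (2025) §5 (the tree's `coordBlowupSubst`).
-/

noncomputable section

-- single-conjunct summit: the doubled namespace component `ResolutionOfSingularities` is mandated
set_option linter.dupNamespace false

open MvPolynomial Module
open Literature.RingTheory.HilbertSamuel
open Literature.RingTheory.MvPolynomial (shift shift_X shift_injective)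
open Literature.AlgebraicGeometry.Resolution

namespace Summit.ResolutionOfSingularities.ResolutionOfSingularities.Theorems

namespace CampaignW42

universe u

variable {K : Type u} [Field K] {n : ℕ} (j : Fin n)

/-! ## The blow-up substitution `φ_j` is injective -/

/-- **`φ_j : X_i ↦ X_j X_i` (`i ≠ j`), `X_j ↦ X_j` is injective**: it is the monomial map of the injective
additive exponent map `α ↦ α + (Σ_{i ≠ j} α_i) e_j`. [folklore] -/
theorem coordBlowupSubst_univ_injective :
    Function.Injective (coordBlowupSubst K (Set.univ : Set (Fin n)) j) := by
  let ψ : (Fin n →₀ ℕ) →+ ℕ := ∑ i ∈ Finset.univ.erase j, Finsupp.applyAddHom i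
  let φ : (Fin n →₀ ℕ) →+ (Fin n →₀ ℕ) := AddMonoidHom.id _ + (Finsupp.singleAddHom j).comp ψ
  have hφapp : ∀ α : Fin n →₀ ℕ, φ α = α + Finsupp.single j (∑ i ∈ Finset.univ.erase j, α i) := by
    intro α
    simp only [φ, ψ, AddMonoidHom.add_apply, AddMonoidHom.id_apply, AddMonoidHom.coe_comp,
      Function.comp_apply, Finsupp.singleAddHom_apply, AddMonoidHom.finsetSum_apply,
      Finsupp.applyAddHom_apply]
  have hφinj : Function.Injective φ := by
    intro α β h
    have h' : ∀ i, (φ α) i = (φ β) i := fun i => by rw [h]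
    have hne : ∀ i, i ≠ j → α i = β i := fun i hi => by
      have := h' i
      simpa only [hφapp, Finsupp.add_apply, Finsupp.single_apply, Ne.symm hi, if_false, add_zero]
        using this
    ext i
    by_cases hi : i = j
    · subst hi
      have h2 := h' i
      simp only [hφapp, Finsupp.add_apply, Finsupp.single_eq_same] at h2
      have hs : ∑ k ∈ Finset.univ.erase i, α k = ∑ k ∈ Finset.univ.erase i, β k :=
        Finset.sum_congr rfl fun k hk => hne k (Finset.ne_of_mem_erase hk)
      omega
    · exact hne i hi
  -- `φ_j` is the monomial map of `φ`
  have hmon : ∀ (s : Fin n →₀ ℕ) (a : K),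
      AddMonoidAlgebra.mapDomainAlgHom K K φ (monomial s a : MvPolynomial (Fin n) K) = monomial (φ s) a :=
    fun s a => by simp [MvPolynomial, monomial]
  have heq : (coordBlowupSubst K (Set.univ : Set (Fin n)) j) =
      (AddMonoidAlgebra.mapDomainAlgHom K K φ : MvPolynomial (Fin n) K →ₐ[K] MvPolynomial (Fin n) K) := by
    refine MvPolynomial.algHom_ext fun i => ?_
    conv_rhs => rw [show (X i : MvPolynomial (Fin n) K) = monomial (Finsupp.single i 1) 1 from rfl, hmon,
      hφapp]
    by_cases hi : i = j
    · subst hi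
      rw [coordBlowupSubst_X_self, Finset.sum_eq_zero (fun k hk => by
        rw [Finsupp.single_apply, if_neg (Finset.ne_of_mem_erase hk).symm]), Finsupp.single_zero, add_zero]
      rfl
    · rw [coordBlowupSubst_X_of_mem_of_ne K Set.univ j (Set.mem_univ i) hi,
        Finset.sum_eq_single_of_mem i (Finset.mem_erase.mpr ⟨hi, Finset.mem_univ i⟩) (fun k _ hk => by
          rw [Finsupp.single_apply, if_neg (Ne.symm hk)]), Finsupp.single_eq_same, add_comm]
      change monomial (Finsupp.single j 1) (1 : K) * monomial (Finsupp.single i 1) 1 = _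
      rw [monomial_mul, one_mul]
  rw [heq]
  intro x y h
  exact AddMonoidAlgebra.mapDomain_injective hφinj h

section Twist

variable (Λ : MvPolynomial (Fin n) K →ₐ[K] MvPolynomial (Fin n) K) (hΛj : Λ (X j) = X j + 1)
  (hΛ : ∀ i, i ≠ j → Λ (X i) = X i * (X j + 1))

include hΛj hΛ in
/-- `Λ = τ_{e_j} ∘ φ_j`. [folklore] -/
theorem twist_eq_shift_comp_coordBlowupSubst :
    Λ = (shift (Pi.single j (1 : K))).comp (coordBlowupSubst K (Set.univ : Set (Fin n)) j) := by
  refine MvPolynomial.algHom_ext fun i => ?_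
  rw [AlgHom.comp_apply]
  by_cases hi : i = j
  · subst hi
    rw [hΛj, coordBlowupSubst_X_self, shift_X, Pi.single_eq_same, C_1]
  · have h0 : (Pi.single j (1 : K) : Fin n → K) i = 0 := Pi.single_eq_of_ne hi 1
    rw [hΛ i hi, coordBlowupSubst_X_of_mem_of_ne K Set.univ j (Set.mem_univ i) hi, map_mul, shift_X,
      shift_X, Pi.single_eq_same, h0, C_1, C_0, add_zero, mul_comm]

include hΛj hΛ in
/-- `Λ` is injective. [folklore] -/
theorem twist_injective : Function.Injective Λ := by
  rw [twist_eq_shift_comp_coordBlowupSubst j Λ hΛj hΛ, AlgHom.coe_comp]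
  exact (shift_injective _).comp (coordBlowupSubst_univ_injective j)

include hΛj hΛ in
/-- **`Λ(f) = (X_j + 1)^d · f(X_j := 1)` for a form `f` of degree `d`.** [folklore] -/
theorem twist_of_isHomogeneous {f : MvPolynomial (Fin n) K} {d : ℕ} (hf : f.IsHomogeneous d) :
    Λ f = (X j + 1) ^ d * dehomog K j f := by
  rw [twist_eq_shift_comp_coordBlowupSubst j Λ hΛj hΛ, AlgHom.comp_apply,
    coordBlowupSubst_univ_eq_of_isHomogeneous j hf, map_mul, map_pow, shift_X, Pi.single_eq_same, C_1,
    shift_single_dehomog]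

include hΛj hΛ in
/-- **`Λ(I) ⊆ J = I.map (dehomog K j)`** for a homogeneous ideal `I`. [folklore] -/
theorem twist_mem_map_dehomog {I : Ideal (MvPolynomial (Fin n) K)} (hI : IsHomogeneousIdeal I)
    {f : MvPolynomial (Fin n) K} (hf : f ∈ I) : Λ f ∈ I.map (dehomog K j) := by
  rw [← sum_homogeneousComponent f, map_sum]
  refine Ideal.sum_mem _ fun e _ => ?_
  rw [twist_of_isHomogeneous j Λ hΛj hΛ (homogeneousComponent_isHomogeneous e f)]
  exact Ideal.mul_mem_left _ _ (Ideal.mem_map_of_mem _ (hI f hf e))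

include hΛj hΛ in
/-- `I ⊆ Λ⁻¹(J)`. [folklore] -/
theorem le_comap_twist_map_dehomog {I : Ideal (MvPolynomial (Fin n) K)} (hI : IsHomogeneousIdeal I) :
    I ≤ (I.map (dehomog K j)).comap (Λ : MvPolynomial (Fin n) K →+* MvPolynomial (Fin n) K) :=
  fun _ hf => twist_mem_map_dehomog j Λ hΛj hΛ hI hf

include hΛj hΛ in
/-- **Saturation**: for every `g` there are `N` and `g̃` with `(X_j + 1)^N g = Λ(g̃)` (`Λ(S) ∋ X_j` and
`X_i (X_j + 1)`). [folklore] -/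
theorem exists_pow_mul_eq_twist (g : MvPolynomial (Fin n) K) :
    ∃ (N : ℕ) (g' : MvPolynomial (Fin n) K), (X j + 1) ^ N * g = Λ g' := by
  induction g using MvPolynomial.induction_on with
  | C a => exact ⟨0, C a, by rw [pow_zero, one_mul, MvPolynomial.algHom_C, MvPolynomial.algebraMap_eq]⟩
  | add p q hp hq =>
    obtain ⟨N, p', hp'⟩ := hp
    obtain ⟨M, q', hq'⟩ := hq
    refine ⟨N + M, X j ^ M * p' + X j ^ N * q', ?_⟩
    rw [map_add, map_mul, map_mul, map_pow, map_pow, hΛj, ← hp', ← hq']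
    ring
  | mul_X p i hp =>
    obtain ⟨N, p', hp'⟩ := hp
    by_cases hi : i = j
    · subst hi
      refine ⟨N, p' * (X i - 1), ?_⟩
      rw [map_mul, map_sub, map_one, hΛj, ← hp']
      ring
    · refine ⟨N + 1, p' * X i, ?_⟩
      rw [map_mul, hΛ i hi, ← hp']
      ring

include hΛj in
/-- `(X_j + 1)^N = Λ(X_j^N)`. [folklore] -/
theorem X_add_one_pow_eq_twist (N : ℕ) : (X j + 1 : MvPolynomial (Fin n) K) ^ N = Λ (X j ^ N) := by
  rw [map_pow, hΛj]

include hΛj hΛ in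
/-- **Saturation on `J`**: for `g ∈ J = I.map (dehomog K j)` (`I` homogeneous) there are `N` and `y ∈ I` with
`(X_j + 1)^N g = Λ(y)`. [folklore] -/
theorem exists_pow_mul_eq_twist_of_mem_map_dehomog {I : Ideal (MvPolynomial (Fin n) K)}
    (hI : IsHomogeneousIdeal I) {g : MvPolynomial (Fin n) K} (hg : g ∈ I.map (dehomog K j)) :
    ∃ N : ℕ, ∃ y ∈ I, (X j + 1) ^ N * g = Λ y := by
  rw [Ideal.map] at hg
  refine Submodule.span_induction ?_ ⟨0, 0, I.zero_mem, by rw [mul_zero, map_zero]⟩ ?_ ?_ hg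
  · rintro _ ⟨f, hf, rfl⟩
    -- `f = Σ_e f_e`, `(X_j+1)^N dehomog f_e = Λ(X_j^{N-e} f_e)`
    refine ⟨f.totalDegree, ∑ e ∈ Finset.range (f.totalDegree + 1),
      X j ^ (f.totalDegree - e) * homogeneousComponent e f, I.sum_mem fun e _ =>
        Ideal.mul_mem_left _ _ (hI f hf e), ?_⟩
    have hsplit : (X j + 1 : MvPolynomial (Fin n) K) ^ f.totalDegree * dehomog K j f =
        ∑ e ∈ Finset.range (f.totalDegree + 1), (X j + 1) ^ f.totalDegree *
          dehomog K j (homogeneousComponent e f) := by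
      rw [← Finset.mul_sum, ← map_sum, sum_homogeneousComponent f]
    rw [hsplit, map_sum]
    refine Finset.sum_congr rfl fun e he => ?_
    have he' : e ≤ f.totalDegree := Nat.lt_succ_iff.mp (Finset.mem_range.mp he)
    rw [map_mul, map_pow, hΛj, twist_of_isHomogeneous j Λ hΛj hΛ (homogeneousComponent_isHomogeneous e f),
      ← mul_assoc, ← pow_add, Nat.sub_add_cancel he']
  · rintro x y - - ⟨N, a, ha, hx⟩ ⟨M, b, hb, hy⟩
    refine ⟨N + M, X j ^ M * a + X j ^ N * b, I.add_mem (I.mul_mem_left _ ha) (I.mul_mem_left _ hb), ?_⟩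
    rw [map_add, map_mul, map_mul, ← X_add_one_pow_eq_twist j Λ hΛj, ← X_add_one_pow_eq_twist j Λ hΛj,
      ← hx, ← hy]
    ring
  · rintro a x - ⟨N, y, hy, hx⟩
    obtain ⟨M, a', ha'⟩ := exists_pow_mul_eq_twist j Λ hΛj hΛ a
    refine ⟨M + N, a' * y, I.mul_mem_left _ hy, ?_⟩
    rw [smul_eq_mul, map_mul, ← ha', ← hx]
    ring



/-! ## `(S/I)_{Λ⁻¹𝔮'} ≅ (S/J)_{𝔮'}`: the local rings of the cone and of the blow-up have the same Hilbert function -/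

section Localization

variable {I : Ideal (MvPolynomial (Fin n) K)} (hI : IsHomogeneousIdeal I) {𝔮' : Ideal (MvPolynomial (Fin n) K)}
  [𝔮'.IsPrime] (hJ𝔮' : I.map (dehomog K j) ≤ 𝔮') (hXj : (X j : MvPolynomial (Fin n) K) ∈ 𝔮')

include hXj in
/-- `X_j + 1 ∉ 𝔮'` when `X_j ∈ 𝔮'`. [folklore] -/
theorem X_add_one_not_mem : (X j + 1 : MvPolynomial (Fin n) K) ∉ 𝔮' := fun h =>
  (inferInstance : 𝔮'.IsPrime).ne_top ((Ideal.eq_top_iff_one _).mpr (by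
    have h1 := 𝔮'.sub_mem h hXj
    rwa [add_sub_cancel_left] at h1))

include hXj in
/-- `(X_j + 1)^N t ∉ 𝔮'` for `t ∉ 𝔮'`. [folklore] -/
theorem X_add_one_pow_mul_not_mem {t : MvPolynomial (Fin n) K} (ht : t ∉ 𝔮') (N : ℕ) :
    (X j + 1 : MvPolynomial (Fin n) K) ^ N * t ∉ 𝔮' := fun h =>
  ((inferInstance : 𝔮'.IsPrime).mem_or_mem h).elim
    (fun h1 => X_add_one_not_mem j hXj ((inferInstance : 𝔮'.IsPrime).mem_of_pow_mem N h1)) ht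

include hI hΛj hΛ hJ𝔮' hXj in
/-- **The local ring of the cone `C = V(I)` at `Λ⁻¹(𝔮')` and the local ring of the strict transform
`V(J)` (`J = I.map (dehomog K j)`) at a point `𝔮' ∋ X_j` of the exceptional hyperplane have the same Hilbert
function**: `(S/J)_{𝔮'}` is a localization of `S/I` at `Λ⁻¹(𝔮')/I` along `Λ` (units: `Λ(s) ∉ 𝔮'` for
`s ∉ Λ⁻¹𝔮'`; surjectivity and kernel by saturation with the unit `X_j + 1` and injectivity of `Λ`), and
localizations at the same prime have equal Hilbert functions. For a CONE this is the product structure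
`Bl_0(C) ∩ U_j ≅ (C ∩ {X_j = 1}) × 𝔸¹`. [cite: CossartJannsenSaito2020, Thm. 3.14 (proof)] -/
theorem hilbertFun_localization_comap_twist_eq
    [((𝔮'.comap (Λ : MvPolynomial (Fin n) K →+* MvPolynomial (Fin n) K)).map (Ideal.Quotient.mk I)).IsPrime]
    [(𝔮'.map (Ideal.Quotient.mk (I.map (dehomog K j)))).IsPrime] :
    hilbertFun (Localization.AtPrime
        ((𝔮'.comap (Λ : MvPolynomial (Fin n) K →+* MvPolynomial (Fin n) K)).map (Ideal.Quotient.mk I))) =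
      hilbertFun (Localization.AtPrime (𝔮'.map (Ideal.Quotient.mk (I.map (dehomog K j))))) := by
  set J : Ideal (MvPolynomial (Fin n) K) := I.map (dehomog K j) with hJ
  set 𝔪 : Ideal (MvPolynomial (Fin n) K) :=
    𝔮'.comap (Λ : MvPolynomial (Fin n) K →+* MvPolynomial (Fin n) K) with h𝔪
  set L' := Localization.AtPrime (𝔮'.map (Ideal.Quotient.mk J))
  have hIJ : I ≤ J.comap (Λ : MvPolynomial (Fin n) K →+* MvPolynomial (Fin n) K) :=
    le_comap_twist_map_dehomog j Λ hΛj hΛ hI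
  have hI𝔪 : I ≤ 𝔪 := hIJ.trans (Ideal.comap_mono hJ𝔮')
  have hmem𝔪 : ∀ s, s ∈ 𝔪 ↔ Λ s ∈ 𝔮' := fun s => Ideal.mem_comap
  have hmkI : ∀ s, Ideal.Quotient.mk I s ∈ 𝔪.map (Ideal.Quotient.mk I) ↔ s ∈ 𝔪 := fun s => by
    rw [Ideal.mem_quotient_iff_mem_sup, sup_eq_left.mpr hI𝔪]
  have hmkJ : ∀ s, Ideal.Quotient.mk J s ∈ 𝔮'.map (Ideal.Quotient.mk J) ↔ s ∈ 𝔮' := fun s => by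
    rw [Ideal.mem_quotient_iff_mem_sup, sup_eq_left.mpr hJ𝔮']
  have hXj𝔪 : ∀ N : ℕ, (X j : MvPolynomial (Fin n) K) ^ N ∉ 𝔪 := fun N h => by
    rw [hmem𝔪, map_pow, hΛj, ← mul_one ((X j + 1 : MvPolynomial (Fin n) K) ^ N)] at h
    exact X_add_one_pow_mul_not_mem j hXj (fun h1 => (inferInstance : 𝔮'.IsPrime).ne_top
      ((Ideal.eq_top_iff_one _).mpr h1)) N h
  let Λbar : (MvPolynomial (Fin n) K ⧸ I) →+* MvPolynomial (Fin n) K ⧸ J :=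
    Ideal.quotientMap J (Λ : MvPolynomial (Fin n) K →+* MvPolynomial (Fin n) K) hIJ
  have hΛbar : ∀ s, Λbar (Ideal.Quotient.mk I s) = Ideal.Quotient.mk J (Λ s) := fun s =>
    Ideal.quotientMap_mk
  letI : Algebra (MvPolynomial (Fin n) K ⧸ I) L' :=
    ((algebraMap (MvPolynomial (Fin n) K ⧸ J) L').comp Λbar).toAlgebra
  have halg : ∀ s, algebraMap (MvPolynomial (Fin n) K ⧸ I) L' (Ideal.Quotient.mk I s) =
      algebraMap (MvPolynomial (Fin n) K ⧸ J) L' (Ideal.Quotient.mk J (Λ s)) := fun s => by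
    rw [RingHom.algebraMap_toAlgebra, RingHom.comp_apply, hΛbar]
  haveI : IsLocalization.AtPrime L' (𝔪.map (Ideal.Quotient.mk I)) := by
    rw [IsLocalization.AtPrime, isLocalization_iff]
    refine ⟨?_, ?_, ?_⟩
    · rintro ⟨y, hy⟩
      obtain ⟨s, rfl⟩ := Ideal.Quotient.mk_surjective y
      have hs : Λ s ∉ 𝔮' := fun h => hy ((hmkI s).mpr ((hmem𝔪 s).mpr h))
      rw [halg]
      exact IsLocalization.map_units L' (⟨Ideal.Quotient.mk J (Λ s), fun h => hs ((hmkJ _).mp h)⟩ :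
        (𝔮'.map (Ideal.Quotient.mk J)).primeCompl)
    · intro z
      obtain ⟨⟨r', t'⟩, hz⟩ := IsLocalization.surj (𝔮'.map (Ideal.Quotient.mk J)).primeCompl z
      obtain ⟨g, hg⟩ := Ideal.Quotient.mk_surjective r'
      obtain ⟨t, ht⟩ := Ideal.Quotient.mk_surjective (t' : MvPolynomial (Fin n) K ⧸ J)
      have ht𝔮 : t ∉ 𝔮' := fun h => t'.2 (by rw [← ht]; exact (hmkJ t).mpr h)
      obtain ⟨N, g₁, hg₁⟩ := exists_pow_mul_eq_twist j Λ hΛj hΛ g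
      obtain ⟨M, t₁, ht₁⟩ := exists_pow_mul_eq_twist j Λ hΛj hΛ t
      have ht₁𝔪 : X j ^ N * t₁ ∉ 𝔪 := fun h => ((inferInstance : 𝔪.IsPrime).mem_or_mem h).elim
        (hXj𝔪 N) (fun h1 => X_add_one_pow_mul_not_mem j hXj ht𝔮 M (by rw [ht₁]; exact (hmem𝔪 _).mp h1))
      have key : z * algebraMap (MvPolynomial (Fin n) K ⧸ I) L' (Ideal.Quotient.mk I (X j ^ N * t₁)) =
          algebraMap (MvPolynomial (Fin n) K ⧸ I) L' (Ideal.Quotient.mk I (X j ^ M * g₁)) := by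
        rw [halg, halg, map_mul Λ, map_mul Λ, ← X_add_one_pow_eq_twist j Λ hΛj N,
          ← X_add_one_pow_eq_twist j Λ hΛj M, ← hg₁, ← ht₁]
        rw [← hg, ← ht] at hz
        simp only [map_mul] at hz ⊢
        rw [← hz]
        ring
      exact ⟨⟨Ideal.Quotient.mk I (X j ^ M * g₁), ⟨Ideal.Quotient.mk I (X j ^ N * t₁),
        fun h => ht₁𝔪 ((hmkI _).mp h)⟩⟩, key⟩
    · intro x y hxy
      obtain ⟨a, rfl⟩ := Ideal.Quotient.mk_surjective x
      obtain ⟨b, rfl⟩ := Ideal.Quotient.mk_surjective y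
      rw [halg, halg] at hxy
      obtain ⟨⟨c, hc⟩, hcab⟩ := IsLocalization.exists_of_eq (M := (𝔮'.map (Ideal.Quotient.mk J)).primeCompl) hxy
      obtain ⟨t, rfl⟩ := Ideal.Quotient.mk_surjective c
      have ht𝔮 : t ∉ 𝔮' := fun h => hc ((hmkJ t).mpr h)
      have hmem : t * Λ (a - b) ∈ J := by
        rw [map_sub, mul_sub, ← Ideal.Quotient.eq, map_mul, map_mul]
        exact hcab
      obtain ⟨N, y0, hy0, hNy⟩ := exists_pow_mul_eq_twist_of_mem_map_dehomog j Λ hΛj hΛ hI hmem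
      obtain ⟨M, t₁, ht₁⟩ := exists_pow_mul_eq_twist j Λ hΛj hΛ t
      have hkey : t₁ * X j ^ N * (a - b) = X j ^ M * y0 := by
        apply twist_injective j Λ hΛj hΛ
        rw [map_mul, map_mul, map_mul, ← ht₁, ← X_add_one_pow_eq_twist j Λ hΛj,
          ← X_add_one_pow_eq_twist j Λ hΛj, ← hNy]
        ring
      have ht₁𝔪 : t₁ * X j ^ N ∉ 𝔪 := fun h => ((inferInstance : 𝔪.IsPrime).mem_or_mem h).elim
        (fun h1 => X_add_one_pow_mul_not_mem j hXj ht𝔮 M (by rw [ht₁]; exact (hmem𝔪 _).mp h1)) (hXj𝔪 N)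
      refine ⟨⟨Ideal.Quotient.mk I (t₁ * X j ^ N), fun h => ht₁𝔪 ((hmkI _).mp h)⟩, ?_⟩
      change Ideal.Quotient.mk I (t₁ * X j ^ N) * Ideal.Quotient.mk I a =
        Ideal.Quotient.mk I (t₁ * X j ^ N) * Ideal.Quotient.mk I b
      rw [← map_mul, ← map_mul, Ideal.Quotient.eq, ← mul_sub, hkey]
      exact I.mul_mem_left _ hy0
  exact hilbertFun_eq_of_isLocalization_atPrime (𝔪.map (Ideal.Quotient.mk I)) L'

end Localization

end Twist

end CampaignW42

end Summit.ResolutionOfSingularities.ResolutionOfSingularities.Theorems
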